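import Literature.NumberTheory.Automorphic.UnitaryGroupTruncatedKernelClassHighCusp
import Literature.NumberTheory.Automorphic.UnitaryGroupTruncatedKernelHighCuspTwo
import Literature.NumberTheory.Automorphic.UnitaryGroupKernelOffBorelVanishingTwo
import HarnessLib

/-!
# High in the cusp the `𝔬`-part `k^T_𝔬` of Arthur's truncated kernel on `U(J₂)` is `K_𝔬 − K_{B,𝔬}`,
# an average over a fundamental domain of `N(F)` — the per-class high-cusp identity in two variables
(Rogawski, *Automorphic Representations of Unitary Groups in Three Variables* (1990), §2.2 p. 13, for the rank-one
groups `U(3)`, `U(2)`, `U(2) × U(1)` of §7.3 p. 98; Gelbart, *Automorphic forms on adele groups* (1975), §9.B;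
after Arthur, Duke Math. J. 45 (1978), §7, Thm. 7.1, stated and proved CLASS BY CLASS.)

Topic `NumberTheory/Automorphic`; namespace `Literature.NumberTheory.Automorphic.UnitaryGroup`. THEOREMS ONLY over
accepted tree modules: no definition, no named fact, no instance, no notation, no `sorry`. The `N = 2` sibling of the
`section Three` heads of ★ `UnitaryGroupTruncatedKernelClassHighCusp` (whose `section General` —
`borelSumClass_eq_finsetSum_indicator`, every `N` — is USED); the `N`-dependent inputs are the Siegel property and
the off-Borel vanishing at `N = 2` (★ `not_lt_borelHeight_mul_of_not_mem_arithmeticBorel_two`,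
`UnitaryGroupTruncatedKernelHighCuspTwo`; ★ `exists_forall_apply_conj_eq_zero_of_not_mem_arithmeticBorel_two`,
`UnitaryGroupKernelOffBorelVanishingTwo`). H-SIDE copy of LAWS 1–5 (`H = U(Φ₂) × U(Φ₁)`; LEAD WORDs #123∕#124;
census `CENSUS-LAWS-Hside.F0P3a-p03g6.md` §3 LAW 3 «class rows first») of the T1 line
`Cruxes/H413/Lines/F0_T1InnerFormTraceIdentity.lean` (cell `pub/hodgecm-mathlib`, crux H413).

* §1 `exists_forall_kernelClass_eq_borelSumClass_of_lt_borelHeight_two` — `K_𝔬(g, g) = Σ_{β ∈ B(F) ∩ 𝔬̲} f(g⁻¹ β g)`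
  for `H(g) > c₀(f)`, uniformly in the class map and the class.
* §2 `kernelBorelTailClass_mul_eq_zero_of_not_mem_arithmeticBorel_two`,
  **`pseudoEisenstein_kernelBorelTailClass_eq_kernelBorelClass_two`**,
  **`truncatedKernelClass_eq_kernelClass_sub_kernelBorelClass_two`** — for `1 ≤ T < H(g)`:
  `k^T_𝔬(g) = K_𝔬(g, g) − K_{B,𝔬}(g, g)` (Rogawski's two partition axioms).
* §3 `kernelBorelClass_eq_smul_integral_two`, `integrableOn_borelSumClass_translate_two`,
  **`truncatedKernelClass_eq_smul_setIntegral_sub_two`**, **`truncatedKernelClass_eq_smul_setIntegral_finsetSum_sub_two`**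
  — `k^T_𝔬(g) = ν(𝓕)⁻¹ ∫_𝓕 Σ_{β ∈ R ∩ 𝔬̲} [f(g⁻¹ β g) − f(g⁻¹ β u g)] dν(u)` high in the cusp.

## References

* J. D. Rogawski, *Automorphic Representations of Unitary Groups in Three Variables*, Ann. of Math. Stud. 123 (1990),
  §2.2 (p. 13), §7.3 (p. 98) [Rogawski1990].
* S. Gelbart, *Automorphic forms on adele groups*, Ann. of Math. Stud. 83 (1975), §9.B, (9.20), (9.44) [Gelbart1975].
* P. Garrett, *Modern Analysis of Automorphic Forms by Example* (2018), §2.3 [Garrett2018].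
-/

set_option autoImplicit false

noncomputable section

open MeasureTheory Measure NumberField IsDedekindDomain Matrix Topology
open scoped NNReal ENNReal MatrixGroups

namespace Literature.NumberTheory.Automorphic

namespace UnitaryGroup

variable {F E : Type} [Field F] [NumberField F] [Field E] [NumberField E] [Algebra F E]
  {c : E ≃ₐ[F] E} {ι : Type*}

/-! ## §1 `K_𝔬 = ` its Borel part high in the cusp, uniformly in the class -/

/-- **`K_𝔬(g, g) = Σ_{β ∈ B(F) ∩ 𝔬̲} f(g⁻¹ β g)` high in the cusp, uniformly in the class** (`U(J₂)`): for `f` of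
compact support there is `c₀` (that of ★ `exists_forall_apply_conj_eq_zero_of_not_mem_arithmeticBorel_two`:
`f(g⁻¹ γ g) = 0` for `γ ∈ G(F) ∖ B(F)`, `H(g) > c₀`) such that for EVERY class map `cl`, every class `𝔬 = i` and
every `g` with `H(g) > c₀`, the class kernel on the diagonal (★ `kernelClass`) equals its Borel part
(★ `borelSumClass`). [cite: Rogawski1990, §2.2 (p. 13)] [cite: Garrett2018, §2.3] -/
theorem exists_forall_kernelClass_eq_borelSumClass_of_lt_borelHeight_two
    {f : (quasiSplit F E c 2).Adelic → ℂ} (hf : HasCompactSupport f) :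
    ∃ c₀ : ℝ≥0, ∀ (cl : (quasiSplit F E c 2).arithmeticSubgroup → ι) (i : ι)
      (g : (quasiSplit F E c 2).Adelic), c₀ < borelHeight g →
        kernelClass cl i f g g = borelSumClass cl i f g g := by
  obtain ⟨c₀, hc₀⟩ := exists_forall_apply_conj_eq_zero_of_not_mem_arithmeticBorel_two (c := c) hf
  refine ⟨c₀, fun cl i g hg => ?_⟩
  rw [kernelClass_def, borelSumClass_def]
  -- the class-`𝔬` part of `B(F)` embeds into the class-`𝔬` part of `G(F)`
  let e : ((fun β : arithmeticBorel F E c 2 => cl β) ⁻¹' {i}) → (cl ⁻¹' {i}) := fun β =>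
    ⟨((β : arithmeticBorel F E c 2) : (quasiSplit F E c 2).arithmeticSubgroup), β.2⟩
  have he : Function.Injective e := by
    intro β β' h
    apply Subtype.ext
    apply Subtype.ext
    exact congrArg (fun γ : (cl ⁻¹' {i}) => (γ : (quasiSplit F E c 2).arithmeticSubgroup)) h
  -- and carries the support of `γ ↦ f(g⁻¹ γ g)` there, the non-Borel terms vanishing
  have hs : Function.support (fun γ : (cl ⁻¹' {i}) =>
      f (g⁻¹ * ((γ : (quasiSplit F E c 2).arithmeticSubgroup) : (quasiSplit F E c 2).Adelic) * g)) ⊆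
      Set.range e := by
    intro γ hγ
    by_cases hγB : (γ : (quasiSplit F E c 2).arithmeticSubgroup) ∈ arithmeticBorel F E c 2
    · exact ⟨⟨⟨(γ : (quasiSplit F E c 2).arithmeticSubgroup), hγB⟩, γ.2⟩, Subtype.ext rfl⟩
    · exact absurd (hc₀ g hg _ hγB) hγ
  exact (he.tsum_eq hs).symm

/-- `𝔸_E` is Hausdorff (local copy of the standard argument). [folklore] -/
private theorem t2Space_adeleRing_E₂c : T2Space (AdeleRing (𝓞 E) E) := by
  haveI : T2Space (FiniteAdeleRing (𝓞 E) E) := inferInstanceAs <| T2Space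
    (RestrictedProduct (fun w : HeightOneSpectrum (𝓞 E) => w.adicCompletion E)
      (fun w => (w.adicCompletionIntegers E : Set (w.adicCompletion E))) Filter.cofinite)
  haveI : T2Space (InfiniteAdeleRing E) :=
    inferInstanceAs <| T2Space ((w : InfinitePlace E) → w.Completion)
  exact inferInstanceAs <| T2Space (InfiniteAdeleRing E × FiniteAdeleRing (𝓞 E) E)

section Two

variable [MeasurableSpace (adelicUnipotent F E c 2)] [BorelSpace (adelicUnipotent F E c 2)]

/-! ## §2 High in the cusp the class truncation collapses: `k^T_𝔬 = K_𝔬 − K_{B,𝔬}` -/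

omit [BorelSpace (adelicUnipotent F E c 2)] in
/-- The cut-off class Borel diagonal vanishes at every non-Borel translate (`U(J₂)`): `1_{H(γg) > T} K_{B,𝔬}(γg, γg) = 0`
for `γ ∉ B(F)`, `1 ≤ T < H(g)` (★ `not_lt_borelHeight_mul_of_not_mem_arithmeticBorel_two`: no non-Borel translate is
high in the cusp). [cite: Rogawski1990, §2.2 (p. 13)] -/
theorem kernelBorelTailClass_mul_eq_zero_of_not_mem_arithmeticBorel_two (ν : Measure (adelicUnipotent F E c 2))
    (𝓕 : Set (adelicUnipotent F E c 2)) (cl : (quasiSplit F E c 2).arithmeticSubgroup → ι) (i : ι)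
    (f : (quasiSplit F E c 2).Adelic → ℂ)
    {γ : (quasiSplit F E c 2).arithmeticSubgroup} (hγ : γ ∉ arithmeticBorel F E c 2)
    {T : ℝ≥0} (hT : 1 ≤ T) {g : (quasiSplit F E c 2).Adelic} (hg : T < borelHeight g) :
    kernelBorelTailClass ν 𝓕 T cl i f ((γ : (quasiSplit F E c 2).Adelic) * g) = 0 :=
  kernelBorelTailClass_of_not_lt cl i f (not_lt_borelHeight_mul_of_not_mem_arithmeticBorel_two hγ hT hg)

/-- **`Σ_δ 1_{H(δ g) > T} K_{B,𝔬}(δ g, δ g) = K_{B,𝔬}(g, g)` for `1 ≤ T < H(g)`** (`U(J₂)`; every Haar measure `ν` of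
`N(𝔸_F)`, every fundamental domain `𝓕` of `N(F)`, every class of a partition with Rogawski's two axioms): only
`δ ∈ B(F)` survives (★ `pseudoEisenstein_eq_self_of_forall_not_mem`), and the class cut-off tail is left
`B(F)`-invariant (★ `kernelBorelTailClass_rational_borel_mul'` — the one place the axiom `IsUnipotentInvariantOnBorel`
enters). [cite: Rogawski1990, §2.2 (p. 13)] -/
theorem pseudoEisenstein_kernelBorelTailClass_eq_kernelBorelClass_two
    {cl : (quasiSplit F E c 2).arithmeticSubgroup → ι} (hcl : IsConjInvariant cl)
    (hclN : IsUnipotentInvariantOnBorel F E c 2 cl) (ν : Measure (adelicUnipotent F E c 2))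
    [ν.IsHaarMeasure] {𝓕 : Set (adelicUnipotent F E c 2)}
    (h𝓕 : IsFundamentalDomain (rationalUnipotent F E c 2) 𝓕 ν) (i : ι) (f : (quasiSplit F E c 2).Adelic → ℂ)
    {T : ℝ≥0} (hT : 1 ≤ T) {g : (quasiSplit F E c 2).Adelic} (hg : T < borelHeight g) :
    pseudoEisenstein (kernelBorelTailClass ν 𝓕 T cl i f) g = kernelBorelClass ν 𝓕 cl i f g g := by
  rw [pseudoEisenstein_eq_self_of_forall_not_mem
      (kernelBorelTailClass_rational_borel_mul' hcl hclN ν h𝓕 T i f) g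
      (fun γ hγ => kernelBorelTailClass_mul_eq_zero_of_not_mem_arithmeticBorel_two ν 𝓕 cl i f hγ hT hg),
    kernelBorelTailClass_of_lt cl i f hg]

/-- **High in the cusp the class truncated kernel of `U(J₂)` is `K_𝔬 − K_{B,𝔬}`**: for `f` on `U(J₂)(𝔸_F)`, a Haar
measure `ν` of `N(𝔸_F)`, a fundamental domain `𝓕` of `N(F)`, a class map with Rogawski's two axioms and
`1 ≤ T < H(g)`: `k^T_𝔬(g) = K_𝔬(g, g) − K_{B,𝔬}(g, g)` — the per-`𝔬` form of ★ `truncatedKernel_eq_kernel_sub_kernelBorel_two`.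
[cite: Rogawski1990, §2.2 (p. 13)] -/
theorem truncatedKernelClass_eq_kernelClass_sub_kernelBorelClass_two
    {cl : (quasiSplit F E c 2).arithmeticSubgroup → ι} (hcl : IsConjInvariant cl)
    (hclN : IsUnipotentInvariantOnBorel F E c 2 cl) (ν : Measure (adelicUnipotent F E c 2))
    [ν.IsHaarMeasure] {𝓕 : Set (adelicUnipotent F E c 2)}
    (h𝓕 : IsFundamentalDomain (rationalUnipotent F E c 2) 𝓕 ν) (i : ι) (f : (quasiSplit F E c 2).Adelic → ℂ)
    {T : ℝ≥0} (hT : 1 ≤ T) {g : (quasiSplit F E c 2).Adelic} (hg : T < borelHeight g) :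
    truncatedKernelClass ν 𝓕 T cl i f g = kernelClass cl i f g g - kernelBorelClass ν 𝓕 cl i f g g := by
  rw [truncatedKernelClass_def, pseudoEisenstein_kernelBorelTailClass_eq_kernelBorelClass_two hcl hclN ν h𝓕 i f hT hg]

/-! ## §3 `k^T_𝔬` high in the cusp as a fundamental-domain average -/

omit [BorelSpace (adelicUnipotent F E c 2)] in
/-- `K_{B,𝔬}(x, y)` on `U(J₂)` as an explicit normalised integral over `𝓕` (★ `borelConstantTerm_def`; the class analogue
of ★ `kernelBorel_eq_smul_integral`). [cite: Rogawski1990, §2.2 (p. 13)] -/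
theorem kernelBorelClass_eq_smul_integral_two (ν : Measure (adelicUnipotent F E c 2))
    (𝓕 : Set (adelicUnipotent F E c 2)) (cl : (quasiSplit F E c 2).arithmeticSubgroup → ι) (i : ι)
    (f : (quasiSplit F E c 2).Adelic → ℂ) (x y : (quasiSplit F E c 2).Adelic) :
    kernelBorelClass ν 𝓕 cl i f x y = ((ν 𝓕).toReal⁻¹ : ℝ) •
      ∫ u in 𝓕, borelSumClass cl i f x ((u : (quasiSplit F E c 2).Adelic) * y) ∂ν := by
  rw [kernelBorelClass_def, borelConstantTerm_def]

/-- The class `K_B`-integrand `u ↦ Σ_{β ∈ B(F) ∩ 𝔬̲} f(g⁻¹ β u g)` of `U(J₂)` is integrable on a fundamental domain contained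
in a compact set `U`: on `U` it is a FINITE sum of continuous translates of `f` (the finite set of ★
`finite_setOf_exists_conj_mem_of_isCompact` carries every term), and Haar measure is finite on compacta.
[cite: Rogawski1990, §2.2 (p. 13)] -/
theorem integrableOn_borelSumClass_translate_two (ν : Measure (adelicUnipotent F E c 2)) [ν.IsHaarMeasure]
    {𝓕 U : Set (adelicUnipotent F E c 2)} (hU : IsCompact U) (h𝓕U : 𝓕 ⊆ U)
    (cl : (quasiSplit F E c 2).arithmeticSubgroup → ι) (i : ι)
    {f : (quasiSplit F E c 2).Adelic → ℂ} (hfc : Continuous f) (hf : HasCompactSupport f)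
    (g : (quasiSplit F E c 2).Adelic) :
    IntegrableOn (fun u : adelicUnipotent F E c 2 =>
      borelSumClass cl i f g ((u : (quasiSplit F E c 2).Adelic) * g)) 𝓕 ν := by
  haveI := t2Space_adeleRing_E₂c (E := E)
  haveI : T2Space (quasiSplit F E c 2).Adelic :=
    inferInstanceAs (T2Space (adelic F E c 2 ((StdForm.antidiagonal 2).over E)))
  -- the finite set of `β ∈ B(F)` carrying every term `f(g⁻¹ β u g)`, `u ∈ U`
  have hYc : IsCompact ((fun u : adelicUnipotent F E c 2 => (u : (quasiSplit F E c 2).Adelic)) '' U) :=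
    hU.image continuous_subtype_val
  have hfin := finite_setOf_exists_conj_mem_of_isCompact hf.isCompact hYc g
  have hR : ∀ u ∈ U, ∀ β ∉ hfin.toFinset,
      f (g⁻¹ * (((β : (quasiSplit F E c 2).arithmeticSubgroup)) : (quasiSplit F E c 2).Adelic) *
        ((u : (quasiSplit F E c 2).Adelic) * g)) = 0 := by
    intro u hu β hβ
    by_contra h
    exact hβ (hfin.mem_toFinset.2 ⟨(u : (quasiSplit F E c 2).Adelic), ⟨u, hu, rfl⟩,
      subset_tsupport _ (Function.mem_support.2 h)⟩)
  -- on `U` the class Borel sum is a finite sum of continuous translates (or zeros), class by class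
  have hcont : Continuous fun u : adelicUnipotent F E c 2 => ∑ β ∈ hfin.toFinset,
      ((fun β : arithmeticBorel F E c 2 => cl β) ⁻¹' {i}).indicator
        (fun β : arithmeticBorel F E c 2 =>
          f (g⁻¹ * (((β : (quasiSplit F E c 2).arithmeticSubgroup)) : (quasiSplit F E c 2).Adelic) *
            ((u : (quasiSplit F E c 2).Adelic) * g))) β := by
    refine continuous_finsetSum _ fun β _ => ?_
    by_cases hβ : β ∈ (fun β : arithmeticBorel F E c 2 => cl β) ⁻¹' {i}
    · simp only [Set.indicator_of_mem hβ]
      exact hfc.comp (continuous_const.mul (continuous_subtype_val.mul continuous_const))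
    · simp only [Set.indicator_of_notMem hβ]
      exact continuous_const
  have hIU : IntegrableOn (fun u : adelicUnipotent F E c 2 => ∑ β ∈ hfin.toFinset,
      ((fun β : arithmeticBorel F E c 2 => cl β) ⁻¹' {i}).indicator
        (fun β : arithmeticBorel F E c 2 =>
          f (g⁻¹ * (((β : (quasiSplit F E c 2).arithmeticSubgroup)) : (quasiSplit F E c 2).Adelic) *
            ((u : (quasiSplit F E c 2).Adelic) * g))) β) U ν :=
    hcont.continuousOn.integrableOn_compact hU
  refine (hIU.congr_fun (fun u hu => ?_) hU.measurableSet).mono_set h𝓕U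
  exact (borelSumClass_eq_finsetSum_indicator cl i hfin.toFinset (hR u hu)).symm

/-- **`k^T_𝔬(g) = ν(𝓕)⁻¹ ∫_𝓕 [Σ_{β ∈ B(F)∩𝔬̲} f(g⁻¹βg) − Σ_{β ∈ B(F)∩𝔬̲} f(g⁻¹βug)] dν(u)` high in the cusp of `U(J₂)`.**
Hypotheses: Rogawski's two partition axioms, `ν` a Haar measure on `N(𝔸_F)`, `𝓕` a fundamental domain of `N(F)`
contained in a compact set, `f ∈ C_c(G(𝔸_F))`, `1 ≤ T < H(g)` and `K_𝔬(g, g) = Σ_{β ∈ B(F)∩𝔬̲} f(g⁻¹ β g)` (§1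
supplies the latter for `H(g) > c₀(f)`). The per-`𝔬` form of the total identity (Rogawski (1990), §2.2 p. 13:
`k^T_𝔬 = K_𝔬 − K_{B,𝔬}` on the part of the Siegel set above `T`; Gelbart (1975), (9.44)). [cite: Rogawski1990, §2.2 (p. 13)] -/
theorem truncatedKernelClass_eq_smul_setIntegral_sub_two
    {cl : (quasiSplit F E c 2).arithmeticSubgroup → ι} (hcl : IsConjInvariant cl)
    (hclN : IsUnipotentInvariantOnBorel F E c 2 cl) (ν : Measure (adelicUnipotent F E c 2))
    [ν.IsHaarMeasure] {𝓕 U : Set (adelicUnipotent F E c 2)}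
    (h𝓕 : IsFundamentalDomain (rationalUnipotent F E c 2) 𝓕 ν) (hU : IsCompact U) (h𝓕U : 𝓕 ⊆ U) (i : ι)
    {f : (quasiSplit F E c 2).Adelic → ℂ} (hfc : Continuous f) (hf : HasCompactSupport f)
    {T : ℝ≥0} (hT : 1 ≤ T) {g : (quasiSplit F E c 2).Adelic} (hg : T < borelHeight g)
    (hK : kernelClass cl i f g g = borelSumClass cl i f g g) :
    truncatedKernelClass ν 𝓕 T cl i f g = ((ν 𝓕).toReal⁻¹ : ℝ) •
      ∫ u in 𝓕, (borelSumClass cl i f g g -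
        borelSumClass cl i f g ((u : (quasiSplit F E c 2).Adelic) * g)) ∂ν := by
  have h0 : ν 𝓕 ≠ 0 := measure_ne_zero_of_isFundamentalDomain ν h𝓕
  have htop : ν 𝓕 ≠ ∞ := ((measure_mono h𝓕U).trans_lt hU.measure_lt_top).ne
  have hr : (ν 𝓕).toReal ≠ 0 := ENNReal.toReal_ne_zero.2 ⟨h0, htop⟩
  have hc : IntegrableOn (fun _ : adelicUnipotent F E c 2 => borelSumClass cl i f g g) 𝓕 ν :=
    integrableOn_const htop
  rw [truncatedKernelClass_eq_kernelClass_sub_kernelBorelClass_two hcl hclN ν h𝓕 i f hT hg, hK,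
    kernelBorelClass_eq_smul_integral_two,
    integral_sub hc (integrableOn_borelSumClass_translate_two ν hU h𝓕U cl i hfc hf g), setIntegral_const,
    smul_sub]
  congr 1
  rw [measureReal_def, smul_smul, inv_mul_cancel₀ hr, one_smul]

/-- **THE DISPLAYED IDENTITY `k^T_𝔬(g) = ν(𝓕)⁻¹ ∫_𝓕 Σ_{β ∈ R ∩ 𝔬̲} [f(g⁻¹ β g) − f(g⁻¹ β u g)] dν(u)` on `U(J₂)`** for any
finite `R ⊆ B(F)` carrying all the terms `f(g⁻¹ β g)` and `f(g⁻¹ β u g)`, `u ∈ 𝓕`, the class entering as the indicator of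
the fibre `{β | cl β = 𝔬}` on `R` — the per-`𝔬` form of the total displayed identity. [cite: Rogawski1990, §2.2 (p. 13)] -/
theorem truncatedKernelClass_eq_smul_setIntegral_finsetSum_sub_two
    {cl : (quasiSplit F E c 2).arithmeticSubgroup → ι} (hcl : IsConjInvariant cl)
    (hclN : IsUnipotentInvariantOnBorel F E c 2 cl) (ν : Measure (adelicUnipotent F E c 2))
    [ν.IsHaarMeasure] {𝓕 U : Set (adelicUnipotent F E c 2)}
    (h𝓕 : IsFundamentalDomain (rationalUnipotent F E c 2) 𝓕 ν) (hU : IsCompact U) (h𝓕U : 𝓕 ⊆ U) (i : ι)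
    {f : (quasiSplit F E c 2).Adelic → ℂ} (hfc : Continuous f) (hf : HasCompactSupport f)
    {T : ℝ≥0} (hT : 1 ≤ T) {g : (quasiSplit F E c 2).Adelic} (hg : T < borelHeight g)
    (hK : kernelClass cl i f g g = borelSumClass cl i f g g) (R : Finset (arithmeticBorel F E c 2))
    (hR₁ : ∀ β ∉ R,
      f (g⁻¹ * (((β : (quasiSplit F E c 2).arithmeticSubgroup)) : (quasiSplit F E c 2).Adelic) * g) = 0)
    (hR₂ : ∀ β ∉ R, ∀ u ∈ 𝓕,
      f (g⁻¹ * (((β : (quasiSplit F E c 2).arithmeticSubgroup)) : (quasiSplit F E c 2).Adelic) *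
        ((u : (quasiSplit F E c 2).Adelic) * g)) = 0) :
    truncatedKernelClass ν 𝓕 T cl i f g = ((ν 𝓕).toReal⁻¹ : ℝ) • ∫ u in 𝓕, (∑ β ∈ R,
      ((fun β : arithmeticBorel F E c 2 => cl β) ⁻¹' {i}).indicator
        (fun β : arithmeticBorel F E c 2 =>
          f (g⁻¹ * (((β : (quasiSplit F E c 2).arithmeticSubgroup)) : (quasiSplit F E c 2).Adelic) * g) -
          f (g⁻¹ * (((β : (quasiSplit F E c 2).arithmeticSubgroup)) : (quasiSplit F E c 2).Adelic) *
            ((u : (quasiSplit F E c 2).Adelic) * g))) β) ∂ν := by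
  rw [truncatedKernelClass_eq_smul_setIntegral_sub_two hcl hclN ν h𝓕 hU h𝓕U i hfc hf hT hg hK]
  congr 1
  refine setIntegral_congr_fun₀ h𝓕.nullMeasurableSet fun u hu => ?_
  rw [borelSumClass_eq_finsetSum_indicator cl i R hR₁,
    borelSumClass_eq_finsetSum_indicator cl i R (fun β hβ => hR₂ β hβ u hu), ← Finset.sum_sub_distrib]
  refine Finset.sum_congr rfl fun β _ => ?_
  by_cases hβ : β ∈ (fun β : arithmeticBorel F E c 2 => cl β) ⁻¹' {i}
  · simp only [Set.indicator_of_mem hβ]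
  · simp only [Set.indicator_of_notMem hβ, sub_zero]

end Two

end UnitaryGroup

end Literature.NumberTheory.Automorphic
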